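import Summits.Langlands.Langlands.Theorems.QuadraticWindowHostInducedRepMemberPaneArch
import HarnessLib

/-!
# Sub-stub PANE-ARCH with the infinity-type input cut down to rank one
# (line `one-transparent-pane`, crux `QuadraticWindow.HostInducedRep`, stmt-Langlands-10902; v5, third lead)

Companion of `QuadraticWindowHostInducedRepMemberArchInf1.lean` (see its module docstring): the landed
`stub_memberPaneArch` (…MemberPaneArch.lean, p104124) applies the fact-stub `stub_factInf` (infinity types
for every `GL_N` over every number field) only to `GL₁` data over the CM field `K`
(`exists_glOne_archParam_compRelNorm`).  Re-proved here VERBATIM with the hypothesis weakened to the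
rank-one statement `hinf1` (registered stub `stub_memberPaneArch_inf1`).
-/

set_option linter.dupNamespace false -- the summit-side namespace `Summit.Langlands.Langlands.…` repeats `Langlands` by design (D-0017 single-conjunct summit)

noncomputable section

open scoped BigOperators Polynomial Classical
open Filter Set Polynomial IsDedekindDomain NumberField NumberField.InfinitePlace
open Literature.NumberTheory.Automorphic Literature.NumberTheory.GaloisRepresentations
open Summit.Langlands.Langlands.Theorems.HostInducedRep.GrsExplicitDescent

namespace Summit.Langlands.Langlands.Theorems.HostInducedRep.OneTransparentPane

/-- **Sub-stub PANE-ARCH with rank-one infinity-type input (`stub_memberPaneArch_inf1`; facts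
`harch`, `hinf1`).**  Statement and proof of the landed `stub_memberPaneArch` verbatim, with the `GL₁`
data of `θ = ψu νk` and `θ ∘ N_{L/K}` obtained from `hinf1` (rank one over `K`).  From `MemberRel` and
the pane tower: an archimedean parameter `χ` of `P = BC_{L/F}(π ⊗ ω) ⊗ (ψ₀ ∘ N_{L/K})` with
`PaneArchOut`. [cite: Clozel1990, §3.3] -/
theorem stub_memberPaneArch_inf1 : ArthurClozel1989_strongLifting_archimedean → (∀ (K : Type) [Field K] [NumberField K] (hK : isCompact_glFiniteIntegralLevel 1 K) (P : AutomorphicRepData (AutomorphyDatum.gl 1 K hK)), P.exists_hasInfinityType) → ∀ (F₀ F : Type) [Field F₀] [NumberField F₀] [Field F] [NumberField F] [Algebra F₀ F] (τ : F ≃ₐ[F₀] F) (n : ℕ) (hcpt : isCompact_glFiniteIntegralLevel n F) (π : CuspidalAutomorphicRepData n F hcpt) (e : FramedGaloisRep F₀ ℂ 1) (k : ℤ) (ℓ : ℕ) [Fact ℓ.Prime] (eψ : FramedGaloisRep F ℂ 1), Hyps τ n π e k ℓ eψ → ∀ (K : Type) [Field K] [NumberField K] [Algebra F₀ K] [IsCMField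 K] (cK : K ≃ₐ[F₀] K), Module.finrank F₀ K = 2 → cK ≠ 1 → ∀ (L F' : Type) [Field L] [NumberField L] [Field F'] [NumberField F'] [Algebra F₀ L] [Algebra F L] [Algebra K L] [Algebra F' L] [IsScalarTower F₀ F L] [IsScalarTower F₀ K L] [IsGalois K L] (s : L ≃ₐ[F'] L), IsPaneTower τ cK L F' s → ∀ (μ χe : HeckeCharacter F₀) (ω : HeckeCharacter F) (hfin : ω.IsFiniteOrder) (ω₀ : HeckeCharacter F₀) (ψu νk ν : HeckeCharacter K) (Pind : CuspidalAutomorphicRepData (2 * n) F₀ (isCompact_glFiniteIntegralLevel_holds (2 * n) F₀)) (PiK τ' : CuspidalAutomorphicRepData (2 * n) K (isCompact_glFiniteIntegralLevel_holds (2 * n) K)) (P₀ P : CuspidalAutomorphicRepData n L (isCompact_glFiniteIntegralLevel_holds n L)), MemberRel π e eψ k μ χe ω hfin ω₀ ψu νk ν Pind PiK τ' P₀ P → ∃ χ : (L →+* ℂ) → Multiset ℂ, PaneArchOut n k ((χe * ω₀)⁻¹ * μ) P.1 χ := by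
  intro harch hinf1 F₀ F _ _ _ _ _ τ n hcpt π e k ℓ _ eψ hH K _ _ _ _ cK h2K hcK L F' _ _ _ _ _ _ _ _ _ _ _
    s hT μ χe ω hfin ω₀ ψu νk ν Pind PiK τ' P₀ P hrel
  obtain ⟨hTR, -, -, hreg, -⟩ := hH
  obtain ⟨hFL, -⟩ := hT
  obtain ⟨-, -, -, -, hχ₀fin, -, hres, hνk, -, -, -, -, -, hBCL, hPW, hPW'⟩ := hrel
  -- `L/F` is quadratic: Galois, cyclic, of prime degree
  haveI : Algebra.IsQuadraticExtension F L := ⟨hFL⟩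
  haveI : Module.Finite F L := Module.Finite.of_restrictScalars_finite ℚ F L
  haveI : Algebra.IsSeparable F L := Algebra.IsSeparable.of_integral F L
  haveI : IsGalois F L := Algebra.IsQuadraticExtension.isGalois F L
  have hprime : (Module.finrank F L).Prime := by
    rw [hFL]
    exact Nat.prime_two
  -- Step 1: the infinity types of `π ⊗ ω` and of `P₀ = BC_{L/F}(π ⊗ ω)`
  obtain ⟨Tπ, hTπ, hTC, hTreg⟩ := hreg
  have hTπ' : (π.twist ω hfin).1.HasInfinityType Tπ :=
    ⟨hTπ.1, AutomorphicRepData.HasArchParameter.twist π.1 ω hfin hTπ.2⟩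
  have hTP₀ : P₀.1.HasInfinityType (Tπ.baseChange L) :=
    harch.hasInfinityType_baseChange (Algebra.IsQuadraticExtension.isCyclic F L) hprime hBCL hTπ'
  -- Step 2: the `GL₁` data of `θ = ψu νk` and of `θ ∘ N_{L/K}`; the infinity type of `P`
  obtain ⟨χ₁, χ₁L, p, hθ, hp, hpint, hθL, hpL, hpLint⟩ :=
    exists_glOne_archParam_compRelNorm (L := L) (hinf1 K _) (ψu * νk)
  obtain ⟨T, hT, hTa, -⟩ :=
    exists_hasInfinityType_twist_glOne χ₁L hθL hpL hpLint hPW hPW' hTP₀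
  -- Step 3: the exponents of `θ` at the embeddings of `K`
  have hm : ∀ σ : K →+* ℂ, ∃ m : ℤ, p σ = ((k : ℂ) + m) / 2 ∧
      ((((χe * ω₀)⁻¹ * μ).archComponent ((InfinitePlace.mk σ).comap (algebraMap F₀ K)) (-1) :
        ℂˣ) : ℂ) = (-1 : ℂ) ^ m :=
    archParam_embedding_of_restrict hTR h2K χ₁ hθ hp hpint hres hχ₀fin hνk
  refine ⟨fun σ ↦ (T σ).map ArchWeight.a, hT.2, fun σ ↦ ?_⟩
  obtain ⟨m, hpm, hχm⟩ := hm (σ.comp (algebraMap K L))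
  have hTσ : (T σ).map ArchWeight.a =
      ((Tπ (σ.comp (algebraMap F L))).map ArchWeight.a).map (· + p (σ.comp (algebraMap K L))) := by
    rw [hTa σ, InfinityType.baseChange_apply]
  have hplace : InfinitePlace.mk (σ.comp (algebraMap F₀ L)) =
      (InfinitePlace.mk (σ.comp (algebraMap K L))).comap (algebraMap F₀ K) := by
    rw [comap_mk, RingHom.comp_assoc, ← IsScalarTower.algebraMap_eq F₀ K L]
  dsimp only
  rw [hTσ, hplace]
  refine ⟨(hTreg _).map (add_left_injective _), ?_, m, hχm, fun a ha ↦ ?_⟩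
  · rw [Multiset.card_map, Multiset.card_map, hTπ.1.1]
  · obtain ⟨a₀, ha₀, rfl⟩ := Multiset.mem_map.mp ha
    obtain ⟨w₀, hw₀, rfl⟩ := Multiset.mem_map.mp ha₀
    obtain ⟨i, -, hi, -⟩ := hTC _ w₀ hw₀
    exact ⟨i, by simp only [hi, hpm]; ring⟩

end Summit.Langlands.Langlands.Theorems.HostInducedRep.OneTransparentPane

end
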